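import Literature.NumberTheory.Rogawski1990.KottwitzSignPlaceReadings      -- ★ `binary_anisotropic_iff_mul_pos`, ★ diagonal model `kottwitzSign_diagonal_eq_neg_one_iff`, ★ `kottwitzSignAt`∕`kottwitzSignArch(Weight)`
import Literature.NumberTheory.Rogawski1990.AdelicWeightedOrbitalEulerG2   -- ★ `classOrbitalIntegral_classWeight_mul` (class weights factor out of class orbital integrals)
import Literature.NumberTheory.Automorphic.ArchStableClassTorus            -- ★ p839819: `conjClasses_stable_archDiagTorus_eq_range_of_conj`, `archStableOrbitalIntegral_archDiagTorus_eq_sum_of_conj`; brings ★ (V8)-sing per place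
import HarnessLib

/-!
# Kottwitz signs on the archimedean diagonal torus and the SIGNED stable orbital sum at a torus point — the split-singular `γ₀` of `U(2,1)` included
# (Rogawski 1990 §4.1 (4.1.2) pp. 39–40; §8.2 p. 117 «`e(γ₀) = 1`, `e(γ₀′) = −1`», Prop. 8.2.1 (d) p. 118)

Topic `NumberTheory/Rogawski1990`; namespace `Literature.NumberTheory.Rogawski1990` (§1, §3, §4) and `Literature.NumberTheory.Automorphic.UnitaryGroup` (§2, §5).  THEOREMS ONLY
(no definition, no instance, no notation, no named fact, no `sorry`).  Cell `pub/hodgecm-mathlib`, ENGINE T1 (crux H413 = `stmt-HodgeConjecture-24833`); floor-1 preparation,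
count-neutral, under books rows #88 (ST-∞) ∕ #111 (S-d): road D2′∕ROAD-Sd, brick **«(J-sgn) SIGNED `Φ^st_∞` AT `γ₀`»** (F0P3a-p02 (g9)'s offer (o4); LEAD WORDS T8-34 (A) ∕ T8-35 (D),
F0P3a-plan (g9); author F0P3a-p05 (g11)).  Sequel of ★ `KottwitzSignCM` (the class weights `kottwitzSignAt`, `kottwitzSignArch`, `kottwitzSignArchWeight`, the weight-parametric
`archKappaOrbitalIntegral`), ★ `KottwitzSignDiagonalModel` (the diagonal model `diag(a,a,b)`), ★ `KottwitzSignPlaceReadings` §3 (binary hermitian forms over `ℂ`) and ★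
`ArchStableClassTorus` (p839819: the stable class of ANY torus point of `G′_∞ = U(diag α)(L⁺ ⊗ ℝ)`, listed, and `Φ^st_∞` at it as a `Finset.sum`), BY NAME.

WHAT IS PROVED.
* §1 (any field `K`, involution `τ`) **`kottwitzSign_diagonal_comp_perm`** — relabelling the diagonal Gram matrix AND the diagonal element by the same permutation does not change the
  sign (★ `kottwitzSign_congr` at the permutation matrix ★ `monomial ρ 1`); **`kottwitzSign_diagonal_wall_eq_neg_one_iff`** — the diagonal model in the WALL CONVENTION of ★
  `ArchLimitFormula` (`diag(a, b, a)`, the coalescing pair in slots `0, 2`): `e = −1` iff the binary form `⟨t₀, t₂⟩` on the `a`-plane is anisotropic; over `ℂ` with real non-zero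
  weights: **`= −1 ↔ 0 < re(t₀ t₂)`** (DEFINITE `a`-plane = COMPACT wall, centraliser `U(2) × U(1)`: print's `γ₀′`) and **`= 1 ↔ re(t₀ t₂) < 0`** (INDEFINITE `a`-plane = NONCOMPACT
  wall, centraliser `U(1,1) × U(1)`: print's `γ₀`); **`kottwitzSign_conj_diagonal_eq_neg_one_iff_of_slots`** — the same with ARBITRARY slots (two-valued `d`, singular slot `s`,
  `a`-plane `⟨i, j⟩`: `e = −1 ↔ 0 < re(t_i t_j)`).
* §2 (per place `w`, `G_w = archLocal L 3 (diagonal α) w`, `α_i ≠ 0`, `σ_w α_i` real; `z₀ 0 = z₀ 2 ≠ z₀ 1`) **`kottwitzSign_circleDiagonal_wall_eq_one_iff`** ∕ **`…_eq_neg_one_iff`**: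
  the matrix sign of the torus point `diag(z₀)` for the form `σ_w(diag α)` is `+1` iff `re σ_w(α₀) · re σ_w(α₂) < 0` (the noncompact-wall guard `hnc` of (C-bdry)∕(J-nc)) and `−1` iff
  `0 < re σ_w(α₀) · re σ_w(α₂)` (the compact-wall guard `hcw` of (C-cw)∕(J-cw)).
* §3 (global torus `t(z) = archDiagTorus L N α z`, any `N`) **`kottwitzSignAt_archDiagTorus`** (`e_w(t z)` = the matrix sign of `diag(z_w)` for `diag(σ_w α)`),
  **`kottwitzSignArch_mk_archDiagTorus`** (`e_∞(⟦t z⟧) = ∏_w e_w(diag z_w)`), `kottwitzSignArchWeight_mk_archDiagTorus` (as a complex number).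
* §4 (signed stable sums; any `N`, any class weight `w : ConjClasses → ℂ`) **`archStableOrbitalIntegral_classWeight_mul`** — the (ST-∞) spelling
  `archStableOrbitalIntegral … (fun x => w ⟦x⟧ * a x) γ` IS ★ `archKappaOrbitalIntegral … w m a γ`; **`archStableOrbitalIntegral_classWeight_mul_archDiagTorus_eq_sum_of_conj`** —
  at ANY torus point `Φ^st_∞(t z, (w∘⟦·⟧)·a) = Σ_{q ∈ univ.image (ρ ↦ ⟦t(z∘ρ)⟧)} w(q) · Φ(q, a)` (the SIGNED sum of (4.1.2) at `w := kottwitzSignArchWeight`, with §3 evaluating the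
  signs on the list); `archKappaOrbitalIntegral_archDiagTorus_eq_sum_of_conj`.
* §5 (per place, ANY torus point, then `N = 3` at an INDEFINITE place, `z` two-valued with singular slot `k`, slots `ip`∕`im` of positive∕negative weight)
  `stableOrbitalIntegralRel_circleDiagonal_eq_sum_of_conj` (the per-place `Φ^st_w(diag z, a)` as a `Finset.sum` for ARBITRARY `z` — the regular case is ★
  `stableOrbitalIntegralRel_circleDiagonal_eq_sum`), **`image_univ_mk_circleDiagonal_perm_eq_pair`** (the class list IS the pair `{⟦diag(z ∘ swap k ip)⟧, ⟦diag(z ∘ swap k im)⟧}`, distinct —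
  ★ B-p17 `exists_conj_circleDiagonal_perm_of_pos_iff` ∕ `not_exists_conj_circleDiagonal_swap_neg_swap_pos`), **`stableOrbitalIntegralRel_classWeight_mul_circleDiagonal_eq_add`**
  (`Φ^st_w(diag z, (w∘⟦·⟧)·a) = w(C₊)·Φ(C₊, a) + w(C₋)·Φ(C₋, a)` — with §1∕§2 this is print's «`Φ(γ₀, f) − Φ(γ₀′, f)`» at a `(2,1)` place).
HONEST LABEL: HC_CM is proved only modulo the printed citations until rung 0 closes; this file is sign book-keeping and pays nothing by itself.

## References
* [Rogawski1990] J. D. Rogawski, *Automorphic Representations of Unitary Groups in Three Variables*, Ann. of Math. Stud. 123 (1990): §4.1 (4.1.1)–(4.1.2) pp. 39–40 (the signed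
  stable orbital integral, `e(γ′)`), §3.8 Prop. 3.8.1 pp. 30–32, §8.2 p. 117 («`e(γ₀) = 1, e(γ₀′) = −1`»), Prop. 8.2.1 (d) p. 118, §8.3 p. 122 (two classes through the singular point).
* [Kottwitz1983] R. E. Kottwitz, *Sign changes in harmonic analysis on reductive groups*, Trans. AMS 278 (1983), 289–297.
* [BrockerTomDieck1985] Th. Bröcker, T. tom Dieck, *Representations of Compact Lie Groups*, GTM 98 (1985), Ch. IV (3.2) (monomial matrices).
-/

set_option autoImplicit false

noncomputable section

open MeasureTheory Matrix Equiv NumberField NumberField.InfinitePlace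
open Literature.LinearAlgebra.Matrix Literature.NumberTheory.Automorphic Literature.NumberTheory.Automorphic.UnitaryGroup
open scoped MatrixGroups ComplexConjugate

namespace Literature.NumberTheory.Rogawski1990

/-! ## §1 Relabelling invariance of the matrix sign and the diagonal model in the wall convention `diag(a, b, a)` -/

section Matrix

variable {K : Type*} [Field K] (τ : K →+* K)

/-- The permutation matrix `M(ρ, 1)` over a field is invertible. [cite: BrockerTomDieck1985, Ch. IV (3.2)] -/
theorem det_monomial_const_one_ne_zero {n : ℕ} (ρ : Perm (Fin n)) : (monomial ρ (fun _ => (1 : K))).det ≠ 0 := by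
  rw [det_monomial]
  rcases Int.units_eq_one_or (Perm.sign ρ) with h | h <;> simp [h]

/-- A ring homomorphism maps the permutation matrix `M(ρ, 1)` to itself. [cite: BrockerTomDieck1985, Ch. IV (3.2)] -/
theorem monomial_const_one_map {n : ℕ} (ρ : Perm (Fin n)) {S : Type*} [CommRing S] (f : K →+* S) :
    (monomial ρ (fun _ => (1 : K))).map f = monomial ρ (fun _ => (1 : S)) := by
  ext i j
  simp only [map_apply, monomial_apply]
  split_ifs
  · exact map_one f
  · exact map_zero f

/-- **RELABELLING INVARIANCE**: `e_{diag(t ∘ ρ)}(diag(d ∘ ρ)) = e_{diag t}(diag d)` — permuting the coordinates of the diagonal Gram matrix and of the diagonal element TOGETHER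
(★ `kottwitzSign_congr` at `T = M(ρ, 1)`: `ᵗ(τM) · diag t · M = diag(t ∘ ρ)`, `M⁻¹ · diag d · M = diag(d ∘ ρ)`). [cite: Rogawski1990, §4.1 (4.1.2) p. 39] [cite: BrockerTomDieck1985, Ch. IV (3.2)] -/
theorem kottwitzSign_diagonal_comp_perm {n : ℕ} (ρ : Perm (Fin n)) (t d : Fin n → K) :
    kottwitzSign τ (diagonal (t ∘ ρ)) (diagonal (d ∘ ρ)) = kottwitzSign τ (diagonal t) (diagonal d) := by
  set T : GL (Fin n) K := Matrix.GeneralLinearGroup.mkOfDetNeZero _ (det_monomial_const_one_ne_zero (K := K) ρ) with hT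
  have hTval : (T : Matrix (Fin n) (Fin n) K) = monomial ρ (fun _ => (1 : K)) := rfl
  have hform : ((T : Matrix (Fin n) (Fin n) K).map τ)ᵀ * diagonal t * (T : Matrix (Fin n) (Fin n) K) = diagonal (t ∘ ρ) := by
    rw [hTval, monomial_const_one_map, transpose_monomial, monomial_mul_diagonal, monomial_mul_monomial, inv_mul_cancel, monomial_one]
    congr 1
    funext j
    simp only [Function.comp_apply, one_mul, mul_one]
  have helt : ((T⁻¹ : GL (Fin n) K) : Matrix (Fin n) (Fin n) K) * diagonal d * (T : Matrix (Fin n) (Fin n) K) = diagonal (d ∘ ρ) := by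
    have hcomm : diagonal d * (T : Matrix (Fin n) (Fin n) K) = (T : Matrix (Fin n) (Fin n) K) * diagonal (d ∘ ρ) := by
      rw [hTval, diagonal_mul_monomial, monomial_mul_diagonal]
      congr 1
      funext j
      simp only [Function.comp_apply, one_mul, mul_one]
    have hTi : ((T⁻¹ : GL (Fin n) K) : Matrix (Fin n) (Fin n) K) * (T : Matrix (Fin n) (Fin n) K) = 1 := by
      rw [← Units.val_mul, inv_mul_cancel, Units.val_one]
    rw [Matrix.mul_assoc, hcomm, ← Matrix.mul_assoc, hTi, Matrix.one_mul]
  rw [← kottwitzSign_congr (σ := τ) (H := diagonal t) T (diagonal d), hform, helt]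

/-- **THE DIAGONAL MODEL IN THE WALL CONVENTION** (`diag(a, b, a)`: the coalescing eigenvalue `a` in slots `0, 2`, as in ★ `ArchLimitFormula`'s wall `{z 0 = z 2 ≠ z 1}`), over a
domain with `τ` injective, `a − b` a unit, `t₁ ≠ 0`: `e = −1` iff the binary form `⟨t₀, t₂⟩` on the `a`-plane is ANISOTROPIC (★ `kottwitzSign_diagonal_eq_neg_one_iff` relabelled by
`swap 1 2`). [cite: Rogawski1990, §4.1 (4.1.2) p. 39; §8.2 p. 117] -/
theorem kottwitzSign_diagonal_wall_eq_neg_one_iff (hτ : Function.Injective τ) {a b : K} (hab : IsUnit (a - b)) (t : Fin 3 → K) (ht1 : t 1 ≠ 0) :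
    kottwitzSign τ (diagonal t) (diagonal ![a, b, a]) = -1 ↔ ∀ u : Fin 2 → K, t 0 * (τ (u 0) * u 0) + t 2 * (τ (u 1) * u 1) = 0 → u = 0 := by
  have e0 : (Equiv.swap (1 : Fin 3) 2) 0 = 0 := by decide
  have e1 : (Equiv.swap (1 : Fin 3) 2) 1 = 2 := by decide
  have e2 : (Equiv.swap (1 : Fin 3) 2) 2 = 1 := by decide
  have key := kottwitzSign_diagonal_comp_perm τ (Equiv.swap (1 : Fin 3) 2) (t ∘ Equiv.swap (1 : Fin 3) 2) ![a, a, b]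
  have h1 : (t ∘ Equiv.swap (1 : Fin 3) 2) ∘ Equiv.swap (1 : Fin 3) 2 = t := by
    funext i; simp only [Function.comp_apply, Equiv.swap_apply_self]
  have h2 : (![a, a, b] : Fin 3 → K) ∘ Equiv.swap (1 : Fin 3) 2 = ![a, b, a] := by
    funext i
    fin_cases i <;> rfl
  rw [h1, h2] at key
  rw [key, kottwitzSign_diagonal_eq_neg_one_iff τ hτ hab _ (by simpa only [Function.comp_apply, e2] using ht1)]
  simp only [Function.comp_apply, e0, e1]

/-- **Over `ℂ`, real non-zero weights: `e(diag(a,b,a)) = −1 ↔ 0 < re(t₀ t₂)`** — the `a`-plane is DEFINITE, centraliser `U(2) × U(1)` (print's `γ₀′`, the COMPACT wall).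
[cite: Rogawski1990, §8.2 p. 117] -/
theorem kottwitzSign_conj_diagonal_wall_eq_neg_one_iff {a b : ℂ} (hab : a ≠ b) {t : Fin 3 → ℂ} (hreal : ∀ i, (t i).im = 0) (ht0 : ∀ i, t i ≠ 0) :
    kottwitzSign (starRingEnd ℂ) (diagonal t) (diagonal ![a, b, a]) = -1 ↔ 0 < (t 0 * t 2).re := by
  rw [kottwitzSign_diagonal_wall_eq_neg_one_iff (starRingEnd ℂ) (RingHom.injective _) (sub_ne_zero.mpr hab).isUnit t (ht0 1)]
  exact binary_anisotropic_iff_mul_pos (hreal 0) (hreal 2) (ht0 0) (ht0 2)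

/-- **Over `ℂ`, real non-zero weights: `e(diag(a,b,a)) = 1 ↔ re(t₀ t₂) < 0`** — the `a`-plane is INDEFINITE, centraliser `U(1,1) × U(1)` (print's `γ₀`, the NONCOMPACT wall).
[cite: Rogawski1990, §8.2 p. 117] -/
theorem kottwitzSign_conj_diagonal_wall_eq_one_iff {a b : ℂ} (hab : a ≠ b) {t : Fin 3 → ℂ} (hreal : ∀ i, (t i).im = 0) (ht0 : ∀ i, t i ≠ 0) :
    kottwitzSign (starRingEnd ℂ) (diagonal t) (diagonal ![a, b, a]) = 1 ↔ (t 0 * t 2).re < 0 := by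
  have hre : (t 0 * t 2).re = (t 0).re * (t 2).re := by rw [Complex.mul_re, hreal 0, hreal 2, mul_zero, sub_zero]
  have hne : (t 0).re * (t 2).re ≠ 0 :=
    mul_ne_zero (fun h => ht0 0 (Complex.ext h (hreal 0))) (fun h => ht0 2 (Complex.ext h (hreal 2)))
  rcases kottwitzSign_eq_one_or_eq_neg_one (σ := starRingEnd ℂ) (H := diagonal t) (diagonal ![a, b, a]) with h | h
  · refine ⟨fun _ => ?_, fun _ => h⟩
    have hn : ¬ 0 < (t 0 * t 2).re := fun hp => by
      have := (kottwitzSign_conj_diagonal_wall_eq_neg_one_iff hab hreal ht0).mpr hp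
      rw [h] at this
      exact absurd (congrArg Units.val this) (by decide)
    rw [hre] at hn ⊢
    exact lt_of_le_of_ne (not_lt.mp hn) hne
  · refine ⟨fun h1 => ?_, fun hlt => ?_⟩
    · rw [h] at h1; exact absurd (congrArg Units.val h1) (by decide)
    · have hp := (kottwitzSign_conj_diagonal_wall_eq_neg_one_iff hab hreal ht0).mp h
      rw [hre] at hp hlt
      exact absurd hlt (not_lt.mpr hp.le)

/-- A triple of pairwise distinct indices of `Fin 3` is an injective map `Fin 3 → Fin 3`. [folklore] -/
private theorem injective_vecCons_three {i s j : Fin 3} (his : i ≠ s) (hij : i ≠ j) (hsj : s ≠ j) : Function.Injective ![i, s, j] := by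
  intro x y h
  fin_cases x <;> fin_cases y <;> simp_all [eq_comm]

/-- **THE DIAGONAL MODEL WITH ARBITRARY SLOTS, over `ℂ`**: for a two-valued `d : Fin 3 → ℂ` with singular slot `s` (`d m = d s ↔ m = s`, `d` constant off `s`), real non-zero weights `t`,
and the two remaining slots `i ≠ j`: `e_{diag t}(diag d) = −1 ↔ 0 < re(t_i t_j)` — the `a`-plane `⟨i, j⟩` is DEFINITE (relabelling to the wall model by the permutation `(i, s, j) ↦ (0, 1, 2)`,
`kottwitzSign_diagonal_comp_perm`). [cite: Rogawski1990, §4.1 (4.1.2) p. 39; §8.2 p. 117] -/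
theorem kottwitzSign_conj_diagonal_eq_neg_one_iff_of_slots {d : Fin 3 → ℂ} {s : Fin 3} (hs : ∀ m, d m = d s ↔ m = s)
    (hdd : ∀ m m', m ≠ s → m' ≠ s → d m = d m') {t : Fin 3 → ℂ} (hreal : ∀ i, (t i).im = 0) (ht0 : ∀ i, t i ≠ 0)
    {i j : Fin 3} (his : i ≠ s) (hjs : j ≠ s) (hij : i ≠ j) :
    kottwitzSign (starRingEnd ℂ) (diagonal t) (diagonal d) = -1 ↔ 0 < (t i * t j).re := by
  -- the relabelling `κ = (0 ↦ i, 1 ↦ s, 2 ↦ j)`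
  set κ : Perm (Fin 3) := Equiv.ofBijective ![i, s, j] ((Finite.injective_iff_bijective).mp (injective_vecCons_three his hij hjs.symm)) with hκ
  have hκ0 : κ 0 = i := rfl
  have hκ1 : κ 1 = s := rfl
  have hκ2 : κ 2 = j := rfl
  have hd : d ∘ κ = ![d i, d s, d i] := by
    funext m
    fin_cases m
    · simp [hκ0]
    · simp [hκ1]
    · simpa [hκ2] using hdd j i hjs his
  have hdis : d i ≠ d s := fun h => his ((hs i).mp h)
  rw [← kottwitzSign_diagonal_comp_perm (starRingEnd ℂ) κ t d, hd,
    kottwitzSign_conj_diagonal_wall_eq_neg_one_iff (t := t ∘ κ) hdis (fun m => hreal _) (fun m => ht0 _)]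
  simp only [Function.comp_apply, hκ0, hκ2]

end Matrix

end Literature.NumberTheory.Rogawski1990

/-! ## §2 Per place: the sign of a wall point of the compact Cartan of `G_w = U(σ_w diag α)(ℂ)` -/

namespace Literature.NumberTheory.Automorphic.UnitaryGroup

open Literature.NumberTheory.Rogawski1990

section Place

variable (L : Type) [Field L] (α : Fin 3 → L) (w : {w : InfinitePlace L // IsComplex w})

/-- The matrix of the torus point on the wall `{z 0 = z 2}` is the wall model `diag(a, b, a)`. [cite: Rogawski1990, §8.2 Prop. 8.2.1 p. 118] -/
theorem coe_circleDiagonal_eq_diagonal_vec_of_wall {z₀ : Fin 3 → Circle} (h02 : z₀ 0 = z₀ 2) :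
    ((circleDiagonal 3 z₀ : GL (Fin 3) ℂ) : Matrix (Fin 3) (Fin 3) ℂ) = diagonal ![(z₀ 0 : ℂ), (z₀ 1 : ℂ), (z₀ 0 : ℂ)] := by
  rw [coe_circleDiagonal]
  congr 1
  funext i
  fin_cases i
  · rfl
  · rfl
  · simp [h02]

/-- **NONCOMPACT WALL ⇔ `e = +1`**: for `z₀ 0 = z₀ 2 ≠ z₀ 1` the matrix sign of `diag(z₀)` for the form `σ_w(diag α)` is `1` iff `re σ_w(α₀) · re σ_w(α₂) < 0` — exactly the guard `hnc`
of ★ `ArchTorusOrbitalOneSidedLimits` ∕ `ArchLimitFormulaNoncompactWall` (centraliser `U(1,1) × U(1)`, print's `γ₀`, «`e(γ₀) = 1`»). [cite: Rogawski1990, §8.2 p. 117, Prop. 8.2.1 p. 118] -/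
theorem kottwitzSign_circleDiagonal_wall_eq_one_iff (hα : ∀ i, α i ≠ 0) (hreal : ∀ i, (w.1.embedding (α i)).im = 0) {z₀ : Fin 3 → Circle}
    (h02 : z₀ 0 = z₀ 2) (h01 : z₀ 0 ≠ z₀ 1) :
    kottwitzSign (starRingEnd ℂ) ((diagonal α).map w.1.embedding) ((circleDiagonal 3 z₀ : GL (Fin 3) ℂ) : Matrix (Fin 3) (Fin 3) ℂ) = 1 ↔
      (w.1.embedding (α 0)).re * (w.1.embedding (α 2)).re < 0 := by
  rw [coe_circleDiagonal_eq_diagonal_vec_of_wall h02, diagonal_map (map_zero _),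
    kottwitzSign_conj_diagonal_wall_eq_one_iff (fun h => h01 (Circle.ext h)) (fun i => hreal i)
      (fun i => (map_ne_zero_iff _ (RingHom.injective _)).mpr (hα i)),
    Complex.mul_re, hreal 0, hreal 2, mul_zero, sub_zero]

/-- **COMPACT WALL ⇔ `e = −1`**: for `z₀ 0 = z₀ 2 ≠ z₀ 1` the matrix sign of `diag(z₀)` for `σ_w(diag α)` is `−1` iff `0 < re σ_w(α₀) · re σ_w(α₂)` — the guard `hcw` of the
compact-wall theorems (C-cw)∕(J-cw) (centraliser `U(2) × U(1)`, print's `γ₀′`, «`e(γ₀′) = −1`»). [cite: Rogawski1990, §8.2 p. 117, Prop. 8.2.1 p. 118] -/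
theorem kottwitzSign_circleDiagonal_wall_eq_neg_one_iff (hα : ∀ i, α i ≠ 0) (hreal : ∀ i, (w.1.embedding (α i)).im = 0) {z₀ : Fin 3 → Circle}
    (h02 : z₀ 0 = z₀ 2) (h01 : z₀ 0 ≠ z₀ 1) :
    kottwitzSign (starRingEnd ℂ) ((diagonal α).map w.1.embedding) ((circleDiagonal 3 z₀ : GL (Fin 3) ℂ) : Matrix (Fin 3) (Fin 3) ℂ) = -1 ↔
      0 < (w.1.embedding (α 0)).re * (w.1.embedding (α 2)).re := by
  rw [coe_circleDiagonal_eq_diagonal_vec_of_wall h02, diagonal_map (map_zero _),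
    kottwitzSign_conj_diagonal_wall_eq_neg_one_iff (fun h => h01 (Circle.ext h)) (fun i => hreal i)
      (fun i => (map_ne_zero_iff _ (RingHom.injective _)).mpr (hα i)),
    Complex.mul_re, hreal 0, hreal 2, mul_zero, sub_zero]

end Place

end Literature.NumberTheory.Automorphic.UnitaryGroup

/-! ## §3 The global torus `t(z) ∈ G′_∞ = U(diag α)(L⁺ ⊗ ℝ)`: `e_w(t z)`, `e_∞(⟦t z⟧) = ∏_w e_w(diag z_w)` -/

namespace Literature.NumberTheory.Rogawski1990

section Torus

variable (L : Type) [Field L] [NumberField L] [IsCMField L] (N : ℕ) (α : Fin N → L)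

/-- **`e_w(t(z))` IS THE MATRIX SIGN OF `diag(z_w)` FOR `diag(σ_w α)`** (★ `archFormOf_map_evalC`, ★ `coe_archDiagTorus_apply`). [cite: Rogawski1990, §4.1 (4.1.2) p. 39; §8.2 p. 117] -/
theorem kottwitzSignAt_archDiagTorus (z : {w : InfinitePlace L // IsComplex w} → Fin N → Circle) (w : {w : InfinitePlace L // IsComplex w}) :
    kottwitzSignAt L N (diagonal α) w (archDiagTorus L N α z) =
      kottwitzSign (starRingEnd ℂ) (diagonal fun i => w.1.embedding (α i)) (diagonal fun i => (z w i : ℂ)) := by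
  have hm : ((((archDiagTorus L N α z : UnitaryGroup.arch (↥(maximalRealSubfield L)) L (IsCMField.complexConj L) N (diagonal α)) :
        GL (Fin N) (mixedEmbedding.mixedSpace L)) : Matrix (Fin N) (Fin N) (mixedEmbedding.mixedSpace L)).map (UnitaryGroup.evalC L w)) =
      diagonal fun i => (z w i : ℂ) := by
    ext i j
    exact coe_archDiagTorus_apply L N α z i j w
  unfold kottwitzSignAt
  rw [UnitaryGroup.archFormOf_map_evalC, diagonal_map (map_zero _), hm]

open scoped Classical in
/-- **`e_∞(⟦t(z)⟧) = ∏_w e_w(diag z_w)`** — the archimedean class sign of a torus point is the product over the complex places of the per-place matrix signs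
(★ `kottwitzSignArch_mk`). [cite: Rogawski1990, §4.1 (4.1.2) p. 39; §8.2 p. 117] -/
theorem kottwitzSignArch_mk_archDiagTorus (z : {w : InfinitePlace L // IsComplex w} → Fin N → Circle) :
    kottwitzSignArch L N (diagonal α) (ConjClasses.mk (archDiagTorus L N α z)) =
      ∏ w : {w : InfinitePlace L // IsComplex w}, kottwitzSign (starRingEnd ℂ) (diagonal fun i => w.1.embedding (α i)) (diagonal fun i => (z w i : ℂ)) := by
  rw [kottwitzSignArch_mk]
  exact Finset.prod_congr rfl fun w _ => kottwitzSignAt_archDiagTorus L N α z w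

open scoped Classical in
/-- The same as a COMPLEX WEIGHT: `kottwitzSignArchWeight ⟦t z⟧ = ∏_w (e_w(diag z_w) : ℂ)`. [cite: Rogawski1990, §4.1 (4.1.2) p. 39] -/
theorem kottwitzSignArchWeight_mk_archDiagTorus (z : {w : InfinitePlace L // IsComplex w} → Fin N → Circle) :
    kottwitzSignArchWeight L N (diagonal α) (ConjClasses.mk (archDiagTorus L N α z)) =
      ∏ w : {w : InfinitePlace L // IsComplex w},
        (((kottwitzSign (starRingEnd ℂ) (diagonal fun i => w.1.embedding (α i)) (diagonal fun i => (z w i : ℂ)) : ℤˣ) : ℤ) : ℂ) := by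
  rw [kottwitzSignArchWeight, kottwitzSignArch_mk_archDiagTorus, Units.coe_prod, Int.cast_prod]

end Torus

/-! ## §4 The SIGNED stable orbital sum: class weights, and the explicit finite sum at ANY torus point -/

section Signed

variable (L : Type) [Field L] [NumberField L] [IsCMField L] (N : ℕ) (H : Matrix (Fin N) (Fin N) L)
variable [∀ γ : ↥(UnitaryGroup.arch (↥(maximalRealSubfield L)) L (IsCMField.complexConj L) N H),
  MeasurableSpace (↥(UnitaryGroup.arch (↥(maximalRealSubfield L)) L (IsCMField.complexConj L) N H) ⧸
    Subgroup.centralizer ({γ} : Set ↥(UnitaryGroup.arch (↥(maximalRealSubfield L)) L (IsCMField.complexConj L) N H)))]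

/-- **THE (ST-∞) SPELLING IS THE WEIGHT-PARAMETRIC SUM**: `Φ^st_∞(γ, (w∘⟦·⟧)·a) = Φ^w_∞(γ, a)` — a class weight put ON THE FUNCTION (as in ★ `PinSingularArchInnerTransfer`, (ST-∞)) factors
out class by class (★ `classOrbitalIntegral_classWeight_mul`) and gives ★ `archKappaOrbitalIntegral … w m a γ`; at `w := kottwitzSignArchWeight` both are print's SIGNED `Φ^st(γ, f_∞)` of (4.1.2).
[cite: Rogawski1990, §4.1 (4.1.2) pp. 39–40] -/
theorem archStableOrbitalIntegral_classWeight_mul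
    (w : ConjClasses ↥(UnitaryGroup.arch (↥(maximalRealSubfield L)) L (IsCMField.complexConj L) N H) → ℂ)
    (m : OrbitalMeasureFamily ↥(UnitaryGroup.arch (↥(maximalRealSubfield L)) L (IsCMField.complexConj L) N H))
    (a : ↥(UnitaryGroup.arch (↥(maximalRealSubfield L)) L (IsCMField.complexConj L) N H) → ℂ)
    (γ : ↥(UnitaryGroup.arch (↥(maximalRealSubfield L)) L (IsCMField.complexConj L) N H)) :
    archStableOrbitalIntegral L N H m (fun x => w (ConjClasses.mk x) * a x) γ = archKappaOrbitalIntegral L N H w m a γ := by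
  rw [archKappaOrbitalIntegral_def, archStableOrbitalIntegral, stableOrbitalIntegralRel_def]
  exact finsum_mem_congr rfl fun c _ => classOrbitalIntegral_classWeight_mul m w a c

variable {H}
variable (α : Fin N → L)
variable [∀ g : ↥(UnitaryGroup.arch (↥(maximalRealSubfield L)) L (IsCMField.complexConj L) N (diagonal α)),
    MeasurableSpace (↥(UnitaryGroup.arch (↥(maximalRealSubfield L)) L (IsCMField.complexConj L) N (diagonal α)) ⧸
      Subgroup.centralizer ({g} : Set ↥(UnitaryGroup.arch (↥(maximalRealSubfield L)) L (IsCMField.complexConj L) N (diagonal α))))]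

open scoped Classical in
/-- **THE SIGNED STABLE SUM AT AN ARBITRARY TORUS POINT, AS A FINITE SUM**: `Φ^st_∞(t z, (w∘⟦·⟧)·a) = Σ_{q ∈ univ.image (ρ ↦ ⟦t(z∘ρ)⟧)} w(q) · Φ(q, a)` for EVERY class weight `w`, every
family `m`, every `a` — the split-singular `γ₀` of (ST-∞) included (★ `archStableOrbitalIntegral_archDiagTorus_eq_sum_of_conj` + ★ `classOrbitalIntegral_classWeight_mul`); at
`w := kottwitzSignArchWeight L N (diagonal α)` the weights on the list are evaluated by `kottwitzSignArchWeight_mk_archDiagTorus`. [cite: Rogawski1990, §4.1 (4.1.1)–(4.1.2) pp. 39–40; §8.2 Prop. 8.2.1 p. 118] -/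
theorem archStableOrbitalIntegral_classWeight_mul_archDiagTorus_eq_sum_of_conj (hα : ∀ i, α i ≠ 0) (hherm : ∀ i, (IsCMField.complexConj L (α i) : L) = α i)
    (z : {w : InfinitePlace L // IsComplex w} → Fin N → Circle)
    (w : ConjClasses ↥(UnitaryGroup.arch (↥(maximalRealSubfield L)) L (IsCMField.complexConj L) N (diagonal α)) → ℂ)
    (m : OrbitalMeasureFamily ↥(UnitaryGroup.arch (↥(maximalRealSubfield L)) L (IsCMField.complexConj L) N (diagonal α)))
    (a : ↥(UnitaryGroup.arch (↥(maximalRealSubfield L)) L (IsCMField.complexConj L) N (diagonal α)) → ℂ) :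
    archStableOrbitalIntegral L N (diagonal α) m (fun x => w (ConjClasses.mk x) * a x) (archDiagTorus L N α z) =
      ∑ q ∈ Finset.univ.image (fun ρ : {w : InfinitePlace L // IsComplex w} → Perm (Fin N) => ConjClasses.mk (archDiagTorus L N α fun w => z w ∘ ρ w)),
        w q * classOrbitalIntegral m a q := by
  rw [archStableOrbitalIntegral_archDiagTorus_eq_sum_of_conj L N α hα hherm z m]
  exact Finset.sum_congr rfl fun q _ => classOrbitalIntegral_classWeight_mul m w a q

open scoped Classical in
/-- The same for the weight-parametric ★ `archKappaOrbitalIntegral`: `Φ^w_∞(t z, a) = Σ_{q ∈ univ.image (ρ ↦ ⟦t(z∘ρ)⟧)} w(q) · Φ(q, a)` at every torus point.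
[cite: Rogawski1990, §4.1 (4.1.2) pp. 39–40] -/
theorem archKappaOrbitalIntegral_archDiagTorus_eq_sum_of_conj (hα : ∀ i, α i ≠ 0) (hherm : ∀ i, (IsCMField.complexConj L (α i) : L) = α i)
    (z : {w : InfinitePlace L // IsComplex w} → Fin N → Circle)
    (w : ConjClasses ↥(UnitaryGroup.arch (↥(maximalRealSubfield L)) L (IsCMField.complexConj L) N (diagonal α)) → ℂ)
    (m : OrbitalMeasureFamily ↥(UnitaryGroup.arch (↥(maximalRealSubfield L)) L (IsCMField.complexConj L) N (diagonal α)))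
    (a : ↥(UnitaryGroup.arch (↥(maximalRealSubfield L)) L (IsCMField.complexConj L) N (diagonal α)) → ℂ) :
    archKappaOrbitalIntegral L N (diagonal α) w m a (archDiagTorus L N α z) =
      ∑ q ∈ Finset.univ.image (fun ρ : {w : InfinitePlace L // IsComplex w} → Perm (Fin N) => ConjClasses.mk (archDiagTorus L N α fun w => z w ∘ ρ w)),
        w q * classOrbitalIntegral m a q := by
  rw [← archStableOrbitalIntegral_classWeight_mul, archStableOrbitalIntegral_classWeight_mul_archDiagTorus_eq_sum_of_conj L N α hα hherm z w m a]

end Signed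

end Literature.NumberTheory.Rogawski1990

end
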